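/- Free-seat work of EXTRA WIDTH SEAT `ym-line-cbag-p1-w5` (prover-ym-line-cbag-p1-w5-g2-0), route `EguchiKawaiDirectionLadder`
(ideator ym-idea-2, LINE 8), crux `TripleSmallBallMargin` (stmt-QuantumFields-27724): the (a′)-door BY NAME — the v6 object
`FreeTripleSmallBallLe1` (corrected within-cluster stub, `EguchiKawaiDirectionLadderTripleSmallBallMarginDefsV6`) from the conditional triple
bound (the named fact `WeylIntegrationFormulaUN` is discharged in the tree: `weylIntegrationFormulaUN_holds`).  One-line re-export of the route-independent
`freeTripleSmallBall_le_one_of_conditionalTriple`; this file sits in the route cone only because the v6 objects do.  Nothing is claimed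
about the two hypotheses; the Yang–Mills mass gap is untouched (barrier-ledger line). -/
import Summits.QuantumFields.YangMills.Theorems.EguchiKawaiDirectionLadderFreeTripleOfConditional
import Summits.QuantumFields.YangMills.Theorems.EguchiKawaiDirectionLadderTripleSmallBallMarginDefsV6
import Literature.Probability.RandomMatrix.WeylIntegrationFormulaHolds

/-!
# Route `EguchiKawaiDirectionLadder`, crux `TripleSmallBallMargin`: `FreeTripleSmallBallLe1` from the conditional triple bound (by name)

`freeTripleSmallBallLe1_of_conditionalTriple : ConditionalTripleBound → FreeTripleSmallBallLe1` (Weyl's integration formula being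
a THEOREM of the tree — `weylIntegrationFormulaUN_holds`, width seat w4's discharge of this seat's named fact) — the skeleton-v6 object (a′) (= the registered (a♯) `FreeTripleSmallBallRobust` at rank `0`, cf. `freeTripleSmallBallLe1_of_robust`) follows
from the fibrewise conditional triple bound (`ConditionalTripleBound`: two Haar unitaries against a FIXED diagonal link, per-pair factor
`triplePairFactor`, where the XL content sits) and Weyl's integration formula for `U(N)`.
-/

set_option autoImplicit false

noncomputable section

namespace Summit.QuantumFields.YangMills.Theorems.EguchiKawaiDirectionLadder


/-- **The (a′)-door by name**: `ConditionalTripleBound → FreeTripleSmallBallLe1` (Weyl's integration formula supplied by the tree's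
`weylIntegrationFormulaUN_holds`).  Nothing is claimed about the hypothesis (it carries the within-cluster content of
stmt-QuantumFields-27724 in fibrewise product form; cf. `FibreBoundDefs.ProductFibreBound`). -/
theorem freeTripleSmallBallLe1_of_conditionalTriple (hC : ConditionalTripleBound) : FreeTripleSmallBallLe1 :=
  fun η hη => freeTripleSmallBall_le_one_of_conditionalTriple
    Literature.Probability.RandomMatrix.weylIntegrationFormulaUN_holds hC η hη

end Summit.QuantumFields.YangMills.Theorems.EguchiKawaiDirectionLadder

end
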